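import Mathlib.Analysis.Complex.AbsMax
import Mathlib.Analysis.Complex.Liouville
import Mathlib.Analysis.Complex.RemovableSingularity
import Literature.MathematicalPhysics.QuantumFieldTheory.Balaban1983to89.B7Prop3GeneralLinearPdev
import Literature.MathematicalPhysics.QuantumFieldTheory.Balaban1983to89.B7Prop3GeneralAnalytic
import Literature.MathematicalPhysics.QuantumFieldTheory.Balaban1983to89.B7Prop4GeneralLevels

/-!
# `Balaban1983to89.B7Eq123General` — T. Bałaban, *Averaging operations for lattice gauge theories*, Commun. Math. Phys.
**98** (1985) 17–51 [Balaban1985Averaging]: the second-order remainder estimate (123) of Proposition 3 AT A GENERAL REGULAR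
BACKGROUND `V₀`, and with it Proposition 4 (130)–(131) = (161) at a general background, unconditionally

statement-level skeleton of published theorems with citation tags; proofs where landed; nothing here is a claim about the Yang–Mills mass gap

PDF held: `paper:balaban1985-cmp98-averaging` (journal page = PDF page + 16); pp. 36–38, 42 read on the renders
`b2b-balaban-ref1/pages/1985-cmp98-averaging/1985-cmp98-averaging-p020-x2.png … -p022-x2.png, -p026-x2.png` (AS IMAGES).

CITATION HEADER / WHAT IS REPRODUCED.  SKELETON rows **B7.Eq123** (@general background; @flat = `B7Prop3Flat.prop3_flat`)
and the bounds half of **B7.Prop4** / the input **(161)** of row **B7.Eq159** at a general background; cell `lit-balaban`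
(HOME `run/shared/lean/pub/lit-balaban/`), seat p06 gen 2 = unit `lit-balaban-p06`.  p. 36 [PDF 20], verbatim:
*"Let us define Q(V₀, A, c) = (1/i) log(V̿₁)_c, (121) then Q(V₀, A, c) is an analytic function of A and from (120) it
follows that its Taylor expansion begins with a first-order polynomial. Let us denote it by L(Q(V₀)A)_c, thus Q(V₀, A, c) =
L(Q(V₀)A)_c + C(V₀, A, c). (122)  C(V₀, A, c) is an analytic function of A whose Taylor's expansion begins with a second-order
polynomial (a quadratic form), and |C(V₀, A, c)| ≦ C₁L²|A|² < C₁(Lα₁)². (123)"* … *"**Proposition 3.** There exist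
constants C₁, c₃, c₃ ≦ c₂, such that for α₀, α₁ ≦ c₃ the function Q(V₀, A) = (1/i) log V̿₁ is an analytic function of A
satisfying the equalities and bounds (122)–(124).  The constant C₁ depends on d and c₃ depends on d and L."*  p. 38
[PDF 22]: *"|Q_j(U₀, ηA) − L^jηQ_j(U₀)A| < e^{O(1)(L^{2(j−1)}+…+L²)η²α₀}4C₁(L^{j−1} + … + 1)L^jη²α₁², (130)
|Q_j(U₀, ηA)| < 2α₁L^jη (131) for j = 1, …, k"*; p. 42 [PDF 26]: *"From Proposition 4, and especially from (131), we get
|(1/i) log U̿′^j| = |Q_j(U₀, ηA′)| < 2α₁L^jη, (161)"*.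

CARRIERS (REUSED BY NAME, nothing re-declared): `B7Prop3GeneralLinear.Qcov` (121), `.linQcov` («L(Q(V₀)A)_c», the
`t`-derivative at `0` of `t ↦ Q(V₀, tA, c)`), `.Ccov` (122); `B7Eq92Concrete.dbavgCov` (89), `.dbavgCovIter` (90)/(91),
`B7Prop2Explicit.avgIter` (43) / `.pdev` / `.AvgClosed` / `.C0` / `.c2'`; `B7Prop3Flat.expCfg`, `.c3` (`c₃(d,L) =
1/(128(d+1)L)`); `B7Prop4GeneralLevels.logCovIter` / `.linCovIter` (127).  INPUTS BY NAME: the analyticity half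
`B7Prop3GeneralAnalytic.prop3_general_analyticAt_of_le_c3` + the log-domain bound `norm_mlog_dbavgCov_le` (≤ 4) +
`logDomainCov`; [B7] Prop. 1 in the form `B7Prop2Explicit.norm_Wcx_sub_one_le`; the linear half `B7Prop3GeneralTild.linQcov_add`
/ `linQcov_smul` and (126) `B7Prop3GeneralLinearPdev.h3lin_discharge_of_avgClosed`; the conditional k-uniform induction
`B7Prop4GeneralLevels.prop4_general_of_prop3` (whose binder `h3rem` = (123) at a general background was OPEN in Literature).

WHAT THIS FILE PROVES (kernel, 0 sorry, theorems only).
* §1 `norm_sub_smul_deriv_le_of_sphere` (private) — [folklore] second-order Cauchy estimate at the centre of a disc (removable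
  singularities + Cauchy's estimate for `g′(0)` + maximum modulus): `‖g t − t·g′(0)‖ ≤ (2M/R²)|t|²`.
* §2 `blockLoops_of_pdev` — small plaquette deviation ⇒ the block loops `V₀(Γ_{c,x})V₀(c)⁻¹` at every `L`-bond are within
  `16(d+1)(d+4)L²β ≤ 1/64` of `1` ([B7] p. 25 / Prop. 1, `norm_Wcx_sub_one_le`).
* §3 **`norm_Ccov_le`** = **(123) AT A GENERAL BACKGROUND**: `V₀` unit-bounded with `α`-regular block loops at `c`
  (`α ≤ 1/64`), `sup_b|A_b| ≤ a ≤ c₃(d,L)` ⇒ `|C(V₀, A, c)| ≤ (8/c₃²)·a²`; `norm_Ccov_le_explicit`: `8/c₃² = 131072(d+1)²·L²`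
  = «C₁L²», `C₁ = C₁(d)`; pdev-currency `norm_Ccov_le_of_pdev`.  Route = print's («analytic … Taylor's expansion begins with
  a second-order polynomial»): the ray `t ↦ Q(V₀, tA, c)` vanishes at `0`, is analytic with `|·| ≤ 4` on `|t| ≤ c₃/a`, §1.
* §4 `h3rem_of_pdev`, `linQcov_sub_of_loops` — the two remaining binders of `prop4_general_of_prop3` in Literature.
* §5 **`prop4_general`** — PROPOSITION 4 (130)/(131) AT EVERY LEVEL `j ≤ k` AT A GENERAL REGULAR BACKGROUND, k-UNIFORM,
  UNCONDITIONAL: `U₀` `G`-valued (`AvgClosed`), `pdev U₀ < α₀L^{−2k}` ((52)), `C₀α₀ ≤ 1/3`, `4α₀ ≤ c₂′(d,L)`; `sup‖B‖ ≤ b`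
  («B = iηA, |A| < α₁»); smallness `e^{4cα₀}(1 + 8C₁Lᵏb) ≤ 2` («e^{O(1)2α₀}(1 + 8C₁α₁)α₁ < 2α₁») with `c = 800(d+1)²(d+4)`,
  `C₁ = 131072(d+1)²`, and `2Lᵏb ≤ c₃(d,L)` («α₁ ≦ ½c₃») ⇒ (130) `‖Q_j − L^jηQ_jB‖ ≤ 8C₁e^{4cα₀}(L^jb)²`, (131) `‖Q_j‖ ≤ 2L^jb`.
* §6 **`dbavgCovIter_eq_expCfg_logCovIter`**, **`norm_mlog_dbavgCovIter_le`** — «(1/i) log U̿₁ᵏ … is a composition of the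
  functions (127)» and **(161)**: `U̿₁ʲ = e^{Q_j(U₀, ηB)}` bondwise and `‖(1/i) log U̿₁ʲ‖ ≤ 2Lʲb`, `1 ≤ j ≤ k`.
DIVERGENCES from print (located): strict `<` ↦ `≤`; thresholds displayed separately (print's `c₄(d,L)` = their minimum);
(136) not typed; global sup bounds on `ℤᵈ` (lineage convention, `η` absorbed: `b` plays `ηα₁`).
RELATION TO THE SUBSTRATE (cell pub-balaban, `Summits/…/Support/ShellMeasureAverageProp3Remainder`, `…Prop4General`): the
same printed facts were certified there on top of a Summits-side Cauchy lemma; this is the Literature-side certification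
(imports Literature + Mathlib only), with the threshold `a ≤ c₃` (not `c₃/2`) in (123).  Nothing of the substrate is restated
as a definition.
-/

noncomputable section

open scoped BigOperators
open NormedSpace Metric Set Finset

namespace Literature.MathematicalPhysics.QuantumFieldTheory.Balaban1983to89.B7Eq123General

open B7Prop1Explicit B7Prop2Explicit B7Prop3Flat B7Eq92Concrete MatrixLog B7Prop3GeneralAnalytic B7Prop3GeneralLinear
  B7Prop4GeneralInduction B7Prop4GeneralLevels
open B7Prop3GeneralTild (linQcov_add linQcov_smul)
open B7Prop3GeneralLinearPdev (h3lin_discharge_of_avgClosed)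

-- `Site` alone would resolve to the torus sites of `Setup.lean`; re-export the `ℤ^d` sites of `B7Prop1Explicit`.
export B7Prop1Explicit (Site)

/-! ## §1 [folklore] The second-order Cauchy estimate at the centre of a disc -/

section Cauchy

variable {F : Type*} [NormedAddCommGroup F] [NormedSpace ℂ F] [CompleteSpace F]

/-- **Second-order Cauchy estimate at the centre of a disc**: `g` complex-differentiable on the closed disc `|t| ≤ R`,
`g 0 = 0`, `‖g‖ ≤ M` on the circle `|t| = R` ⟹ `‖g t − t·g′(0)‖ ≤ (2M/R²)·|t|²` for `|t| ≤ R` (removable singularities: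
`g t − t g′(0) = t²·ψ(t)` with `ψ` differentiable, `‖ψ‖ ≤ 2M/R²` on the circle by Cauchy's estimate for `g′(0)`, hence inside
by the maximum modulus principle).  (`private`: a generic Mathlib-level helper, not a statement of the source.) [folklore] -/
private theorem norm_sub_smul_deriv_le_of_sphere {g : ℂ → F} {R M : ℝ} (hR : 0 < R)
    (hg : DifferentiableOn ℂ g (closedBall 0 R)) (hM : ∀ z ∈ sphere (0 : ℂ) R, ‖g z‖ ≤ M) (h0 : g 0 = 0)
    {t : ℂ} (ht : ‖t‖ ≤ R) : ‖g t - t • deriv g 0‖ ≤ 2 * M / R ^ 2 * ‖t‖ ^ 2 := by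
  have hcl : closure (ball (0 : ℂ) R) = closedBall 0 R := closure_ball 0 hR.ne'
  have hfr : frontier (ball (0 : ℂ) R) = sphere 0 R := frontier_ball 0 hR.ne'
  have hnhds : closedBall (0 : ℂ) R ∈ nhds (0 : ℂ) := closedBall_mem_nhds 0 hR
  -- the two difference quotients
  set φ : ℂ → F := dslope g 0 with hφ
  set ψ : ℂ → F := dslope φ 0 with hψ
  have hφd : DifferentiableOn ℂ φ (closedBall 0 R) := (Complex.differentiableOn_dslope hnhds).2 hg
  have hψd : DifferentiableOn ℂ ψ (closedBall 0 R) := (Complex.differentiableOn_dslope hnhds).2 hφd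
  have hφ_eq : ∀ s : ℂ, s • φ s = g s := fun s => by
    have := sub_smul_dslope g 0 s
    rwa [sub_zero, h0, sub_zero] at this
  have hψ_eq : ∀ s : ℂ, s • ψ s = φ s - deriv g 0 := fun s => by
    have := sub_smul_dslope φ 0 s
    rwa [sub_zero, hφ, dslope_same] at this
  -- `DiffContOnCl` on the open disc for `g` and `ψ`
  have hgc : DiffContOnCl ℂ g (ball 0 R) := DifferentiableOn.diffContOnCl (by rw [hcl]; exact hg)
  have hψc : DiffContOnCl ℂ ψ (ball 0 R) := DifferentiableOn.diffContOnCl (by rw [hcl]; exact hψd)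
  -- Cauchy's estimate for `g′(0)`
  have hg' : ‖deriv g 0‖ ≤ M / R := Complex.norm_deriv_le_of_forall_mem_sphere_norm_le hR hgc hM
  -- `‖ψ‖ ≤ 2M/R²` on the circle
  have hψS : ∀ z ∈ sphere (0 : ℂ) R, ‖ψ z‖ ≤ 2 * M / R ^ 2 := by
    intro z hz
    have hzR : ‖z‖ = R := mem_sphere_zero_iff_norm.1 hz
    have h1 : R * ‖φ z‖ ≤ M := by
      have := congrArg (‖·‖) (hφ_eq z)
      simp only [norm_smul, hzR] at this
      rw [this]; exact hM z hz
    have h2 : R * ‖ψ z‖ ≤ M / R + M / R := by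
      have := congrArg (‖·‖) (hψ_eq z)
      simp only [norm_smul, hzR] at this
      rw [this]
      refine (norm_sub_le _ _).trans (add_le_add ?_ hg')
      rw [le_div_iff₀ hR]; linarith
    rw [le_div_iff₀ (by positivity)]
    have : R * (R * ‖ψ z‖) ≤ R * (M / R + M / R) := mul_le_mul_of_nonneg_left h2 hR.le
    have hRR : R * (M / R + M / R) = 2 * M := by field_simp; ring
    nlinarith
  -- maximum modulus principle for `ψ` on the disc
  have hψt : ‖ψ t‖ ≤ 2 * M / R ^ 2 :=
    Complex.norm_le_of_forall_mem_frontier_norm_le isBounded_ball hψc (by rw [hfr]; exact hψS)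
      (by rw [hcl]; exact mem_closedBall_zero_iff.2 ht)
  -- `g t − t·g′(0) = t²·ψ(t)`
  have hrem : g t - t • deriv g 0 = t • (t • ψ t) := by
    rw [hψ_eq t, smul_sub, hφ_eq t]
  rw [hrem, norm_smul, norm_smul]
  have ht0 : 0 ≤ ‖t‖ := norm_nonneg t
  calc ‖t‖ * (‖t‖ * ‖ψ t‖) ≤ ‖t‖ * (‖t‖ * (2 * M / R ^ 2)) := by gcongr
    _ = 2 * M / R ^ 2 * ‖t‖ ^ 2 := by ring

end Cauchy

variable {d : ℕ}
variable {𝔸 : Type*} [NormedRing 𝔸] [NormedAlgebra ℂ 𝔸] [CompleteSpace 𝔸] [NormOneClass 𝔸]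

/-! ## §2 Small plaquette deviation ⇒ regular block loops at every `L`-bond ([B7] p. 25, Proposition 1) -/

/-- **p. 25, «|V₀(Γ_{c,x}) − 1| < |Γ_{c,x}|dLα₀ < (2d+1)LdLα₀ = O(1)L²α₀», in plaquette-deviation currency**: `pdev V₀ < β`
and `1024(d+1)(d+4)L²β ≤ 1` give `‖V₀(Γ_{c,x})V₀(c)⁻¹ − 1‖ ≤ 16(d+1)(d+4)L²β ≤ 1/64` at every `L`-bond `c = (q, κ)` and every
`x ∈ B(c₋)` (b07's `B7Prop2Explicit.norm_Wcx_sub_one_le`). [cite: Balaban1985Averaging, p.25 (displays before (47))] -/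
theorem blockLoops_of_pdev {L : ℕ} (hL : 1 ≤ L) {V₀ : Site d → Fin d → 𝔸ˣ}
    (hV₀ : ∀ x κ, V₀ x κ ∈ U1 𝔸) {β : ℝ} (hβ0 : 0 ≤ β) (hβ : pdev V₀ < β)
    (hβmax : β ≤ 1 / (1024 * ((d : ℝ) + 1) * ((d : ℝ) + 4) * (L : ℝ) ^ 2)) (q : Site d) (κ : Fin d) :
    (∀ r : Fin d → Fin L,
      ‖((Wcx L V₀ q κ (boxVec L r) : 𝔸ˣ) : 𝔸) - 1‖ ≤ 16 * ((d : ℝ) + 1) * ((d : ℝ) + 4) * (L : ℝ) ^ 2 * β) ∧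
    16 * ((d : ℝ) + 1) * ((d : ℝ) + 4) * (L : ℝ) ^ 2 * β ≤ 1 / 64 := by
  have hL0 : (0 : ℝ) < L := by exact_mod_cast hL
  have hX : (0 : ℝ) < 1024 * ((d : ℝ) + 1) * ((d : ℝ) + 4) * (L : ℝ) ^ 2 := by positivity
  have hXβ : 1024 * ((d : ℝ) + 1) * ((d : ℝ) + 4) * (L : ℝ) ^ 2 * β ≤ 1 := by
    have := mul_le_mul_of_nonneg_left hβmax hX.le
    rwa [one_div, mul_inv_cancel₀ hX.ne'] at this
  refine ⟨fun r => ?_, by nlinarith⟩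
  have h := norm_Wcx_sub_one_le L hL V₀ hV₀ hβ0 (by nlinarith)
    (fun x κ₁ κ₂ _ => (le_pdev hV₀ x κ₁ κ₂).trans hβ.le) q κ r
  refine h.trans (le_of_eq ?_)
  ring

/-! ## §3 (123) at a general regular background: the second-order remainder by the Cauchy estimate along the ray -/

/-- print's threshold in the `θ`-currency of `B7Prop3GeneralAnalytic`: `a ≤ c₃(d, L) = 1/(128(d+1)L)` gives
`(2d+2)L·a ≤ 1/64` (private arithmetic helper). [cite: Balaban1985Averaging, Proposition 3 p.36] -/
private theorem theta_le_of_le_c3 {L : ℕ} (hL : 1 ≤ L) {a : ℝ} (hac : a ≤ c3 d L) :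
    ((2 * (d * L) + L + L : ℕ) : ℝ) * a ≤ 1 / 64 := by
  have hL1 : (1 : ℝ) ≤ L := by exact_mod_cast hL
  have hcast : ((2 * (d * L) + L + L : ℕ) : ℝ) = 2 * ((d : ℝ) + 1) * L := by push_cast; ring
  rw [hcast]
  have hpos : (0 : ℝ) < 128 * ((d : ℝ) + 1) * L := by positivity
  have h1 : a * (128 * ((d : ℝ) + 1) * L) ≤ 1 := by
    have := mul_le_mul_of_nonneg_right hac hpos.le
    rwa [c3, one_div, inv_mul_cancel₀ hpos.ne'] at this
  nlinarith

/-- **[B7] PROPOSITION 3, (123) AT A GENERAL BACKGROUND** — *"C(V₀, A, c) is an analytic function of A whose Taylor's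
expansion begins with a second-order polynomial (a quadratic form), and |C(V₀, A, c)| ≦ C₁L²|A|² < C₁(Lα₁)². (123)"*: for
`V₀` unit-bounded with `α`-regular block loops at the `L`-bond `c = (q, κ)` (`α ≤ 1/64`; print's (44)/(109)
«|V₀(∂p) − 1| < α₀» gives this by Prop. 1, `blockLoops_of_pdev`) and `sup_b|A_b| ≤ a ≤ c₃(d, L)`:
`‖C(V₀, A, c)‖ ≤ (8/c₃(d,L)²)·a²`.  Proof (print's route «analytic … begins with a second-order polynomial»): the ray
`t ↦ Q(V₀, tA, c)` vanishes at `t = 0`, is analytic with `|·| ≤ 4` on the disc `|t| ≤ c₃/a` (the analyticity half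
`prop3_general_analyticAt_of_le_c3`, `norm_mlog_dbavgCov_le`), its derivative at `0` IS «L(Q(V₀)A)_c», and §1 at `t = 1`.
[cite: Balaban1985Averaging, Proposition 3 (123) p.36] -/
theorem norm_Ccov_le {L : ℕ} (hL : 1 ≤ L) {V₀ : Site d → Fin d → 𝔸ˣ} (hV₀ : ∀ x κ, V₀ x κ ∈ U1 𝔸)
    (A : Site d → Fin d → 𝔸) {a α : ℝ} (ha : 0 ≤ a) (hA : ∀ x κ, ‖A x κ‖ ≤ a) (hac : a ≤ c3 d L)
    (q : Site d) (κ : Fin d) (hα1 : α ≤ 1 / 64)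
    (hreg : ∀ r : Fin d → Fin L, ‖((Wcx L V₀ q κ (boxVec L r) : 𝔸ˣ) : 𝔸) - 1‖ ≤ α) :
    ‖Ccov L V₀ A q κ‖ ≤ 8 / (c3 d L) ^ 2 * a ^ 2 := by
  rcases ha.eq_or_lt with h0 | hpos
  · -- the degenerate field `A = 0`
    have hA0 : A = 0 := by
      funext x κ'
      have := hA x κ'
      rw [← h0] at this
      exact norm_le_zero_iff.1 this
    subst hA0
    have hlin : linQcov L V₀ (0 : Site d → Fin d → 𝔸) q κ = 0 := by
      simp only [linQcov, smul_zero, Qcov_zero, deriv_const]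
    rw [Ccov, Qcov_zero, hlin, sub_zero, norm_zero]
    positivity
  -- the ray function and the radius `R = c₃/a ≥ 1`
  set g : ℂ → 𝔸 := fun t : ℂ => Qcov L V₀ (t • A) q κ with hg
  set R : ℝ := c3 d L / a with hR
  have hR1 : 1 ≤ R := by rw [hR, le_div_iff₀ hpos]; linarith
  have hR0 : 0 < R := by linarith
  have hdisc : ∀ t : ℂ, ‖t‖ ≤ R → ‖t‖ * a ≤ c3 d L := fun t ht => by
    rw [hR, le_div_iff₀ hpos] at ht; exact ht
  have htA : ∀ t : ℂ, ∀ x κ', ‖(t • A) x κ'‖ ≤ ‖t‖ * a := fun t x κ' => by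
    rw [Pi.smul_apply, Pi.smul_apply, norm_smul]; exact mul_le_mul_of_nonneg_left (hA x κ') (norm_nonneg _)
  -- analytic on the closed disc
  have hDiff : DifferentiableOn ℂ g (closedBall 0 R) := fun t ht => by
    have han : AnalyticAt ℂ g t :=
      prop3_general_analyticAt_of_le_c3 (fun t : ℂ => t • A)
        (fun x κ' => by simp only [Pi.smul_apply]; exact analyticAt_id.smul analyticAt_const)
        hL hV₀ (by positivity) (htA t) (hdisc t (mem_closedBall_zero_iff.1 ht)) q κ hα1 hreg
    exact han.differentiableAt.differentiableWithinAt
  -- bounded by `4` on the circle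
  have hM : ∀ t ∈ sphere (0 : ℂ) R, ‖g t‖ ≤ 4 := fun t ht =>
    norm_mlog_dbavgCov_le hL hV₀ (t • A) (a := ‖t‖ * a) (by positivity) (htA t) le_rfl (by positivity)
      (theta_le_of_le_c3 hL (hdisc t (mem_sphere_zero_iff_norm.1 ht).le)) q κ hα1 hreg
  -- vanishes at the centre
  have h0 : g 0 = 0 := by simp only [hg, zero_smul]; exact Qcov_zero L V₀ q κ
  -- §1 at `t = 1`
  have h := norm_sub_smul_deriv_le_of_sphere hR0 hDiff hM h0 (t := 1) (by rw [norm_one]; exact hR1)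
  rw [norm_one, one_pow, mul_one, one_smul] at h
  have hg1 : g 1 = Qcov L V₀ A q κ := by simp only [hg, one_smul]
  have hgd : deriv g 0 = linQcov L V₀ A q κ := rfl
  rw [hg1, hgd] at h
  rw [Ccov]
  refine h.trans (le_of_eq ?_)
  have ha' : a ≠ 0 := hpos.ne'
  have hc : c3 d L ≠ 0 := (c3_pos d hL).ne'
  rw [hR, div_pow]
  field_simp
  ring

/-- print's constant made explicit: `8/c₃(d, L)² = 131072·(d+1)²·L²` — «C₁L²» with `C₁ = 131072(d+1)²` depending on `d`
only («The constant C₁ depends on d»). [cite: Balaban1985Averaging, Proposition 3 (123) p.36] -/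
theorem norm_Ccov_le_explicit {L : ℕ} (hL : 1 ≤ L) {V₀ : Site d → Fin d → 𝔸ˣ} (hV₀ : ∀ x κ, V₀ x κ ∈ U1 𝔸)
    (A : Site d → Fin d → 𝔸) {a α : ℝ} (ha : 0 ≤ a) (hA : ∀ x κ, ‖A x κ‖ ≤ a) (hac : a ≤ c3 d L)
    (q : Site d) (κ : Fin d) (hα1 : α ≤ 1 / 64)
    (hreg : ∀ r : Fin d → Fin L, ‖((Wcx L V₀ q κ (boxVec L r) : 𝔸ˣ) : 𝔸) - 1‖ ≤ α) :
    ‖Ccov L V₀ A q κ‖ ≤ 131072 * ((d : ℝ) + 1) ^ 2 * (L : ℝ) ^ 2 * a ^ 2 := by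
  refine (norm_Ccov_le hL hV₀ A ha hA hac q κ hα1 hreg).trans (le_of_eq ?_)
  have hL0 : (0 : ℝ) < L := by exact_mod_cast hL
  have hpos : (0 : ℝ) < 128 * ((d : ℝ) + 1) * L := by positivity
  rw [c3]
  field_simp
  ring

/-- **(123) in plaquette currency**: `V₀` unit-bounded with `pdev V₀ < β ≤ 1/(1024(d+1)(d+4)L²)` («|V₀(∂p) − 1| < α₀»,
(109)), `sup_b|A_b| ≤ a ≤ c₃(d,L)` ⇒ `‖C(V₀, A, c)‖ ≤ 131072(d+1)²L²·a²` at EVERY `L`-bond `c`.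
[cite: Balaban1985Averaging, Proposition 3 (123) p.36, (109) p.34] -/
theorem norm_Ccov_le_of_pdev {L : ℕ} (hL : 1 ≤ L) {V₀ : Site d → Fin d → 𝔸ˣ} (hV₀ : ∀ x κ, V₀ x κ ∈ U1 𝔸)
    {β : ℝ} (hβ0 : 0 ≤ β) (hβ : pdev V₀ < β) (hβmax : β ≤ 1 / (1024 * ((d : ℝ) + 1) * ((d : ℝ) + 4) * (L : ℝ) ^ 2))
    (A : Site d → Fin d → 𝔸) {a : ℝ} (ha : 0 ≤ a) (hA : ∀ x κ, ‖A x κ‖ ≤ a) (hac : a ≤ c3 d L)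
    (q : Site d) (κ : Fin d) :
    ‖Ccov L V₀ A q κ‖ ≤ 131072 * ((d : ℝ) + 1) ^ 2 * (L : ℝ) ^ 2 * a ^ 2 := by
  obtain ⟨hreg, hα1⟩ := blockLoops_of_pdev hL hV₀ hβ0 hβ hβmax q κ
  exact norm_Ccov_le_explicit hL hV₀ A ha hA hac q κ hα1 hreg

/-! ## §4 The two remaining binders of `B7Prop4GeneralLevels.prop4_general_of_prop3`, in Literature -/

/-- **the binder `h3rem` of `B7Prop4GeneralLevels.prop4_general_of_prop3` SUPPLIED** (`βmax := 1/(1024(d+1)(d+4)L²)`,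
`c₃ := c₃(d,L)`, `C₁ := 131072(d+1)²`): for every background `V₀` in a subgroup `G ≤ {|u| ≤ 1, |u⁻¹| ≤ 1}` with
`pdev V₀ < β ≤ βmax`, every field with `sup_b‖A_b‖ ≤ a ≤ c₃(d,L)` and every `L`-bond: `‖Q(V₀, A, c) − L(Q(V₀)A)_c‖ ≤
C₁L²a²` — (123). [cite: Balaban1985Averaging, Proposition 3 (123) p.36] -/
theorem h3rem_of_pdev {L : ℕ} (hL : 1 ≤ L) {G : Subgroup 𝔸ˣ} (hG : G ≤ U1 𝔸) :
    ∀ (V₀ : Site d → Fin d → 𝔸ˣ) (β : ℝ), (∀ x κ, V₀ x κ ∈ G) → 0 ≤ β → pdev V₀ < β →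
      β ≤ 1 / (1024 * ((d : ℝ) + 1) * ((d : ℝ) + 4) * (L : ℝ) ^ 2) →
      ∀ (A : Site d → Fin d → 𝔸) (a : ℝ), 0 ≤ a → a ≤ c3 d L → (∀ x κ, ‖A x κ‖ ≤ a) →
      ∀ q κ, ‖Qcov L V₀ A q κ - linQcov L V₀ A q κ‖ ≤ 131072 * ((d : ℝ) + 1) ^ 2 * (L : ℝ) ^ 2 * a ^ 2 :=
  fun _V₀ _β hVG hβ0 hβ hβmax A _a ha hac hA q κ =>
    norm_Ccov_le_of_pdev hL (fun x κ' => hG (hVG x κ')) hβ0 hβ hβmax A ha hA hac q κ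

/-- **«L(Q(V₀)A)_c» is additive** whenever the block loops at `c` are within `1` of the unit — the linear half's
`linQcov_add` / `linQcov_smul` (closed form (120)/(122), `B7Prop3GeneralTild`) combined: `LQ(A − A′) = LQ A − LQ A′`.
[cite: Balaban1985Averaging, Proposition 3 (122) p.36] -/
theorem linQcov_sub_of_loops (L : ℕ) (V₀ : Site d → Fin d → 𝔸ˣ) (A A' : Site d → Fin d → 𝔸) (q : Site d) (κ : Fin d)
    (hW : ∀ r : Fin d → Fin L, ‖((Wcx L V₀ q κ (boxVec L r) : 𝔸ˣ) : 𝔸) - 1‖ < 1) :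
    linQcov L V₀ (A - A') q κ = linQcov L V₀ A q κ - linQcov L V₀ A' q κ := by
  rw [sub_eq_add_neg, linQcov_add L V₀ A (-A') q κ hW, ← neg_one_smul ℂ A', linQcov_smul L V₀ (-1) A' q κ hW,
    neg_one_smul, ← sub_eq_add_neg]

/-! ## §5 Proposition 4 (130)/(131) at a general regular background, k-uniform — UNCONDITIONAL -/

/-- «α₀ ≦ c₃» in plaquette currency: `4α₀ ≤ c₂′(d,L) = 1/(512(d+1)(d+4)L²)` puts the doubled level regularity `2α₀` of
Prop. 2 (54) below the threshold `βmax = 1/(1024(d+1)(d+4)L²)` of §2–§4 (private arithmetic helper). [cite: Balaban1985Averaging, p.37 (after (127))] -/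
private theorem two_mul_le_betaMax {L : ℕ} {α₀ : ℝ} (hα4 : 4 * α₀ ≤ c2' d L) :
    2 * α₀ ≤ 1 / (1024 * ((d : ℝ) + 1) * ((d : ℝ) + 4) * (L : ℝ) ^ 2) := by
  have h : 1 / (1024 * ((d : ℝ) + 1) * ((d : ℝ) + 4) * (L : ℝ) ^ 2) = c2' d L / 2 := by
    rw [c2', div_div]; congr 1; ring
  rw [h]; linarith

/-- «for α₁ ≦ ½c₃ we can apply Proposition 3 … calculated at Q(U₀, ηA)» (p. 37): `2Lᵏb ≤ c₃` gives `2Lʲb ≤ c₃` at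
every earlier level `j < k` (`L ≥ 1`). [cite: Balaban1985Averaging, p.37 (after (129))] -/
theorem levels_le_c3 {L : ℕ} (hL : 1 ≤ L) {k : ℕ} {b c : ℝ} (hb : 0 ≤ b)
    (hc₃ : 2 * ((L : ℝ) ^ k * b) ≤ c) : ∀ j < k, 2 * ((L : ℝ) ^ j * b) ≤ c := by
  intro j hj
  have hL1 : (1 : ℝ) ≤ L := by exact_mod_cast hL
  have h1 : (L : ℝ) ^ j * b ≤ (L : ℝ) ^ k * b :=
    mul_le_mul_of_nonneg_right (pow_le_pow_right₀ hL1 hj.le) hb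
  linarith

/-- **[B7] PROPOSITION 4, THE BOUNDS (130)/(131) AT EVERY LEVEL `j ≤ k`, AT A GENERAL REGULAR BACKGROUND, k-UNIFORM —
KERNEL, UNCONDITIONAL.**  Data (p. 37 «We assume that U₀ satisfies the assumptions of Proposition 2 and U₁ = e^{iηA},
|A| < α₁»): `L ≥ 2`; `U₀` with values in an averaging-closed subgroup `G` (`B7Prop2Explicit.AvgClosed`), plaquette
deviation `pdev U₀ < α₀L^{−2k}` ((52), `η = L^{−k}`), `C₀α₀ ≤ 1/3` (Prop. 2) and `4α₀ ≤ c₂′(d,L)` («2α₀L^{2j}η² < α₀ ≦ c₃»,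
p. 37); the field `B` («iηA») with `sup‖B‖ ≤ b` («|A| < α₁», `b = ηα₁`); smallness `e^{4cα₀}(1 + 8C₁Lᵏb) ≤ 2` with
`c = 800(d+1)²(d+4)`, `C₁ = 131072(d+1)²` («e^{O(1)2α₀}(1 + 8C₁α₁)α₁ < 2α₁», (131)) and `2Lᵏb ≤ c₃(d,L)` («α₁ ≦ ½c₃»).
CONCLUSION, for every `j ≤ k` and every `Lʲ`-bond: (130) `‖Q_j(U₀, ηB) − LʲηQ_j(U₀)B‖ ≤ 8C₁e^{4cα₀}(Lʲb)²` and (131) =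
(161) `‖Q_j(U₀, ηB)‖ ≤ 2Lʲb`, for the composites `logCovIter`/`linCovIter` (127) of the paper's one-step maps (121)/(122).
Proof: `B7Prop4GeneralLevels.prop4_general_of_prop3` with its three binders supplied by §4 and
`B7Prop3GeneralLinearPdev.h3lin_discharge_of_avgClosed`. [cite: Balaban1985Averaging, Proposition 4 (130)–(131) p.38, (127) p.37] -/
theorem prop4_general (L : ℕ) (hL : 2 ≤ L) {G : Subgroup 𝔸ˣ} (hG : AvgClosed d L G) (k : ℕ)
    (U₀ : Site d → Fin d → 𝔸ˣ) (hU₀ : ∀ x κ, U₀ x κ ∈ G) {α₀ : ℝ} (hα : 0 < α₀)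
    (hα3 : C0 d * α₀ ≤ 1 / 3) (hα4 : 4 * α₀ ≤ c2' d L) (h52 : pdev U₀ < α₀ * (((L : ℝ) ^ k)⁻¹) ^ 2)
    (B : Site d → Fin d → 𝔸) {b : ℝ} (hb : 0 ≤ b) (hB : ∀ x κ, ‖B x κ‖ ≤ b)
    (hsmall : Real.exp (4 * (800 * ((d : ℝ) + 1) ^ 2 * ((d : ℝ) + 4)) * α₀)
      * (1 + 8 * (131072 * ((d : ℝ) + 1) ^ 2) * ((L : ℝ) ^ k * b)) ≤ 2)
    (hc₃ : 2 * ((L : ℝ) ^ k * b) ≤ c3 d L) :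
    ∀ j ≤ k,
      (∀ z κ, ‖logCovIter L U₀ B j z κ - linCovIter L U₀ B j z κ‖
        ≤ 8 * (131072 * ((d : ℝ) + 1) ^ 2) * Real.exp (4 * (800 * ((d : ℝ) + 1) ^ 2 * ((d : ℝ) + 4)) * α₀)
          * ((L : ℝ) ^ j * b) ^ 2) ∧
      (∀ z κ, ‖logCovIter L U₀ B j z κ‖ ≤ 2 * ((L : ℝ) ^ j * b)) := by
  have hL1 : 1 ≤ L := le_trans (by norm_num) hL
  have hα2 : 2 * α₀ ≤ c2' d L := by linarith
  refine prop4_general_of_prop3 L hL hG (C₁ := 131072 * ((d : ℝ) + 1) ^ 2)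
    (c := 800 * ((d : ℝ) + 1) ^ 2 * ((d : ℝ) + 4)) (c₃ := c3 d L)
    (βmax := 1 / (1024 * ((d : ℝ) + 1) * ((d : ℝ) + 4) * (L : ℝ) ^ 2)) (by positivity) (by positivity)
    (h3rem_of_pdev hL1 hG.le_U1) (h3lin_discharge_of_avgClosed hL1 hG) ?_
    k U₀ hU₀ hα hα3 hα2 h52 (two_mul_le_betaMax hα4) B hb hB hsmall (levels_le_c3 hL1 hb hc₃)
  -- the binder `h3sub`: additivity of «LQ» at every background with small plaquette deviation (§2 + §4)
  intro V₀ β hVG hβ0 hβ hβmax A A' q κ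
  obtain ⟨hreg, hα1⟩ := blockLoops_of_pdev hL1 (fun x κ' => hG.le_U1 (hVG x κ')) hβ0 hβ hβmax q κ
  exact linQcov_sub_of_loops L V₀ A A' q κ fun r => ((hreg r).trans hα1).trans_lt (by norm_num)

/-! ## §6 «(1/i) log U̿₁ᵏ … is a composition of the functions (127)» and (161): `U̿₁ʲ = e^{Q_j}`, `‖(1/i) log U̿₁ʲ‖ ≤ 2Lʲb` -/

/-- per-level data: every `Ū₀ʲ`, `j ≤ k`, is unit-bounded with plaquette deviation `< 2α₀(Lʲ/Lᵏ)² ≤ βmax`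
(`B7Prop4GeneralLevels.level_regularity` = Prop. 2 per level, + `two_mul_le_betaMax`). [cite: Balaban1985Averaging, p.37 (after (127)), Prop. 2 (54) p.26] -/
theorem level_data (L : ℕ) (hL : 2 ≤ L) {G : Subgroup 𝔸ˣ} (hG : AvgClosed d L G) (k : ℕ)
    (U₀ : Site d → Fin d → 𝔸ˣ) (hU₀ : ∀ x κ, U₀ x κ ∈ G) {α₀ : ℝ} (hα : 0 < α₀)
    (hα3 : C0 d * α₀ ≤ 1 / 3) (hα4 : 4 * α₀ ≤ c2' d L) (h52 : pdev U₀ < α₀ * (((L : ℝ) ^ k)⁻¹) ^ 2) :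
    ∀ j ≤ k, (∀ x κ, avgIter L U₀ j x κ ∈ U1 𝔸) ∧ 0 ≤ 2 * (α₀ * ((L : ℝ) ^ j * ((L : ℝ) ^ k)⁻¹) ^ 2) ∧
      pdev (avgIter L U₀ j) < 2 * (α₀ * ((L : ℝ) ^ j * ((L : ℝ) ^ k)⁻¹) ^ 2) ∧
      2 * (α₀ * ((L : ℝ) ^ j * ((L : ℝ) ^ k)⁻¹) ^ 2) ≤ 1 / (1024 * ((d : ℝ) + 1) * ((d : ℝ) + 4) * (L : ℝ) ^ 2) := by
  intro j hj
  have hα2 : 2 * α₀ ≤ c2' d L := by linarith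
  have hreg := level_regularity L hL hG k U₀ hU₀ hα hα3 hα2 h52 j hj
  have hL1 : (1 : ℝ) ≤ L := by exact_mod_cast le_trans (by norm_num) hL
  have hLk : (0 : ℝ) < (L : ℝ) ^ k := by positivity
  have hratio : (L : ℝ) ^ j * ((L : ℝ) ^ k)⁻¹ ≤ 1 := by
    rw [mul_inv_le_iff₀ hLk, one_mul]; exact pow_le_pow_right₀ hL1 hj
  have h1 : ((L : ℝ) ^ j * ((L : ℝ) ^ k)⁻¹) ^ 2 ≤ 1 := by
    rw [← one_pow 2]; exact pow_le_pow_left₀ (by positivity) hratio 2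
  refine ⟨fun x κ => hG.le_U1 (hreg.2 x κ), by positivity, hreg.1, ?_⟩
  have := two_mul_le_betaMax (d := d) (L := L) hα4
  nlinarith [mul_le_mul_of_nonneg_left h1 hα.le]

/-- **`U̿₁ʲ = e^{Q_j(U₀, ηB)}` BONDWISE FOR EVERY `j ≤ k`** — p. 37 (127): «(1/i) log U̿₁ᵏ as a function of (1/i) log U₁ is a
composition of the functions Q(U₀, ·), Q(Ū₀, ·), …, Q(Ū₀^{k−1}, ·)»: under the hypotheses of `prop4_general` the iterate
(90)/(91) `dbavgCovIter L U₀ (e^{B}) j` of `U₁ = e^{B}` at the background `U₀` equals `e^{logCovIter L U₀ B j}`.  Induction on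
`j`: at each level the argument has sup norm `≤ 2Lʲb ≤ c₃` ((131)) and the level background is regular (`level_data`), so
`‖V̿₁ − 1‖ ≤ 4/5 < 1` (`B7Prop3GeneralAnalytic.logDomainCov`) and `e^{log V̿₁} = V̿₁` (`B7Prop4Flat.expUnit_mlog`, the series
(21)/(22)). [cite: Balaban1985Averaging, (127) p.37, (90)–(91) p.31, (21)–(22) p.21] -/
theorem dbavgCovIter_eq_expCfg_logCovIter (L : ℕ) (hL : 2 ≤ L) {G : Subgroup 𝔸ˣ} (hG : AvgClosed d L G) (k : ℕ)
    (U₀ : Site d → Fin d → 𝔸ˣ) (hU₀ : ∀ x κ, U₀ x κ ∈ G) {α₀ : ℝ} (hα : 0 < α₀)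
    (hα3 : C0 d * α₀ ≤ 1 / 3) (hα4 : 4 * α₀ ≤ c2' d L) (h52 : pdev U₀ < α₀ * (((L : ℝ) ^ k)⁻¹) ^ 2)
    (B : Site d → Fin d → 𝔸) {b : ℝ} (hb : 0 ≤ b) (hB : ∀ x κ, ‖B x κ‖ ≤ b)
    (hsmall : Real.exp (4 * (800 * ((d : ℝ) + 1) ^ 2 * ((d : ℝ) + 4)) * α₀)
      * (1 + 8 * (131072 * ((d : ℝ) + 1) ^ 2) * ((L : ℝ) ^ k * b)) ≤ 2)
    (hc₃ : 2 * ((L : ℝ) ^ k * b) ≤ c3 d L) :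
    ∀ j ≤ k, dbavgCovIter L U₀ (expCfg B) j = expCfg (logCovIter L U₀ B j) := by
  have hL1 : 1 ≤ L := le_trans (by norm_num) hL
  have hbd := prop4_general L hL hG k U₀ hU₀ hα hα3 hα4 h52 B hb hB hsmall hc₃
  have hlev := level_data L hL hG k U₀ hU₀ hα hα3 hα4 h52
  have hc₃' := levels_le_c3 hL1 hb hc₃
  intro j
  induction j with
  | zero => intro _; rfl
  | succ j ih =>
    intro hjk
    have hj : j < k := Nat.lt_of_succ_le hjk
    obtain ⟨hV₀, hβ0, hβ, hβmax⟩ := hlev j hj.le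
    have hA : ∀ x κ', ‖logCovIter L U₀ B j x κ'‖ ≤ 2 * ((L : ℝ) ^ j * b) := (hbd j hj.le).2
    have hac : 2 * ((L : ℝ) ^ j * b) ≤ c3 d L := hc₃' j hj
    funext z κ
    obtain ⟨hreg, hα1⟩ := blockLoops_of_pdev hL1 hV₀ hβ0 hβ hβmax ((L : ℤ) • z) κ
    have hdom := (logDomainCov hL1 hV₀ (logCovIter L U₀ B j) (by positivity) hA le_rfl (by positivity)
      (theta_le_of_le_c3 hL1 hac) ((L : ℤ) • z) κ hα1 hreg).2.2.2
    have hlt : ‖((dbavgCov L (avgIter L U₀ j) (expCfg (logCovIter L U₀ B j)) ((L : ℤ) • z) κ : 𝔸ˣ) : 𝔸) - 1‖ < 1 :=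
      hdom.trans_lt (by norm_num)
    rw [dbavgCovIter_succ, ih hj.le]
    show _ = expUnit (mlog ((dbavgCov L (avgIter L U₀ j) (expCfg (logCovIter L U₀ B j)) ((L : ℤ) • z) κ : 𝔸ˣ) : 𝔸))
    rw [B7Prop4Flat.expUnit_mlog hlt]

/-- **(161) AT A GENERAL REGULAR BACKGROUND**: *"|(1/i) log U̿′^j| = |Q_j(U₀, ηA′)| < 2α₁L^jη, (161)"* — under the
hypotheses of `prop4_general` (`U′ = e^{B}`, `sup‖B‖ ≤ b` playing `ηα₁`), for `1 ≤ j ≤ k` and every `Lʲ`-bond: the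
logarithm (21) of the `j`-fold double-bar average (91) IS the composite `Q_j(U₀, ηB)` (127), and `‖(1/i) log U̿′^j‖ ≤ 2Lʲb`.
[cite: Balaban1985Averaging, (161) p.42, (131) p.38, (127) p.37] -/
theorem norm_mlog_dbavgCovIter_le (L : ℕ) (hL : 2 ≤ L) {G : Subgroup 𝔸ˣ} (hG : AvgClosed d L G) (k : ℕ)
    (U₀ : Site d → Fin d → 𝔸ˣ) (hU₀ : ∀ x κ, U₀ x κ ∈ G) {α₀ : ℝ} (hα : 0 < α₀)
    (hα3 : C0 d * α₀ ≤ 1 / 3) (hα4 : 4 * α₀ ≤ c2' d L) (h52 : pdev U₀ < α₀ * (((L : ℝ) ^ k)⁻¹) ^ 2)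
    (B : Site d → Fin d → 𝔸) {b : ℝ} (hb : 0 ≤ b) (hB : ∀ x κ, ‖B x κ‖ ≤ b)
    (hsmall : Real.exp (4 * (800 * ((d : ℝ) + 1) ^ 2 * ((d : ℝ) + 4)) * α₀)
      * (1 + 8 * (131072 * ((d : ℝ) + 1) ^ 2) * ((L : ℝ) ^ k * b)) ≤ 2)
    (hc₃ : 2 * ((L : ℝ) ^ k * b) ≤ c3 d L) {j : ℕ} (hjk : j + 1 ≤ k) (z : Site d) (κ : Fin d) :
    mlog ((dbavgCovIter L U₀ (expCfg B) (j + 1) z κ : 𝔸ˣ) : 𝔸) = logCovIter L U₀ B (j + 1) z κ ∧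
      ‖mlog ((dbavgCovIter L U₀ (expCfg B) (j + 1) z κ : 𝔸ˣ) : 𝔸)‖ ≤ 2 * ((L : ℝ) ^ (j + 1) * b) := by
  have hval : mlog ((dbavgCovIter L U₀ (expCfg B) (j + 1) z κ : 𝔸ˣ) : 𝔸) = logCovIter L U₀ B (j + 1) z κ := by
    rw [dbavgCovIter_succ, dbavgCovIter_eq_expCfg_logCovIter L hL hG k U₀ hU₀ hα hα3 hα4 h52 B hb hB hsmall hc₃ j
      (Nat.le_of_succ_le hjk), logCovIter_succ]
    rfl
  exact ⟨hval, hval ▸ (prop4_general L hL hG k U₀ hU₀ hα hα3 hα4 h52 B hb hB hsmall hc₃ (j + 1) hjk).2 z κ⟩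

end Literature.MathematicalPhysics.QuantumFieldTheory.Balaban1983to89.B7Eq123General

end
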